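import Literature.MathematicalPhysics.QuantumFieldTheory.Balaban1983to89.HaarExpChartLocalFaceTransport
import Literature.MeasureTheory.Integral.PushforwardDensityPositivityTransfer

/-!
# THE LOCAL ROUTE AT THE GROUP, POSITIVITY EDITION: a super-density of the push-forward `M_*(r·⊗μ)` that is continuous at `M U₀` is
# POSITIVE there as soon as `r` is continuous and positive at `U₀` and the chart-read map carries at `0` a flat face WITH POSITIVITY

Cell `pub-ymgap` (YM-PLAN Track A), node N09 [B12] width seat `pub-ymgap-dag-n09-w2` g5 (Literature proof lane `--supports` K1⁹
`StabilityBRunRowsAtRecordR13SepCoPHV` = stmt-QuantumFields-27364, count-neutral).  The positivity companion of this seat's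
`HaarExpChartLocalFaceTransport.localFace_pi_haar_of_chartRead` (p618803): the same chart data (§3 `chartData_piExpChart_translate` on both sides at a
radius inside the chart radius and the non-degeneracy ball of `det jac`, an inner source ball inside the chart-readability region) feed the generic
transfer `PushforwardDensityPositivity.density_pos_of_chartRead` (this seat, g5) instead of the transport `localFace_of_chartRead`.  LOCATED CONSUMER: the
positivity half (F3) of N09's road-B regularity tower ([Balaban1987RG1] (0.19) takes `log` of `T_kρ_k`, which must be POSITIVE on the next small-field domain).

WHAT IS PROVED (one theorem; 0 def, 0 sorry).
★★★ `density_pos_pi_haar_of_chartRead` — `B`, `B'` finite bond types, `M : (B → G) → (B' → G)` measurable and continuous at `U₀`; IF the chart-read map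
`A ↦ (b' ↦ Λ(M(Θ^B(A)·U₀) b'·(M U₀ b')⁻¹))` carries at `0` the FLAT local face w.r.t. `⊗_B η`, `⊗_{B'} η` WITH POSITIVITY (the conclusion shape of
`SubmersionPushforward.exists_continuousOn_density_map_of_submersion_pos`: engine form, densities continuous on the window, plus `0 < r̃ 0 → 0 < Ĩ(ψ 0)`), and
`r ≥ 0` is a measurable density on `B → G` continuous and positive at `U₀`, THEN every super-density `I` of `M_*(r·⊗μ)` above an open `DG ∋ M U₀`
(`(r·⊗μ)(M⁻¹S') ≤ ∫⁻_{S'} I d(⊗μ)` for measurable `S' ⊆ DG`) that is continuous at `M U₀` satisfies `0 < I (M U₀)` — via a continuous bump at `0` below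
`(r∘Θ^B(·)·U₀)·J`.

HONEST SCOPE.  Instantiation ∕ bookkeeping only: no chart of Bałaban's constructed, no estimate; the flat face with positivity of the chart-read block
averaging of record (a `C¹`-submersion property on the guard) is the consumer's input; `hreg`∕`contTOn`∕`regSet`∕`TcanOfRecord` untouched; nothing of p28 ∕
dag-n09-w4's files ∕ Mathlib re-proved; no statement about N09 or the Clay problem.
-/

noncomputable section

open NormedSpace Set Function Filter Topology MeasureTheory
open scoped ENNReal NNReal

namespace Literature.MathematicalPhysics.QuantumFieldTheory.Balaban1983to89.HaarExponentialChart

namespace IsChartRep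

open B13HaarSigmaJacobian (jac)
open Literature.MeasureTheory.Integral.PushforwardDensityPositivity (density_pos_of_chartRead)

variable {𝔸 : Type*} [NormedRing 𝔸] [NormedAlgebra ℂ 𝔸] [CompleteSpace 𝔸]
variable {G : Type*} [Group G] [TopologicalSpace G] [IsTopologicalGroup G] [CompactSpace G]
variable {C : LogChart 𝔸} {ρ : G →* 𝔸} (h : IsChartRep C ρ)
variable [MeasurableSpace C.lie] [BorelSpace C.lie] [MeasurableSpace G] [BorelSpace G]
variable {B : Type*} [Fintype B]
variable [FiniteDimensional ℝ C.lie] (hlie : ∀ x ∈ C.lie, ∀ y ∈ C.lie, x * y - y * x ∈ C.lie)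
variable (η : Measure C.lie) [η.IsAddHaarMeasure] (μ : Measure G) [μ.IsHaarMeasure]

include hlie in
/-- ★★★ **POSITIVITY OF A SUPER-DENSITY OF `M_*(r·⊗μ)` AT `M U₀` FROM A FLAT FACE WITH POSITIVITY OF THE CHART-READ MAP.**  See the module docstring.
(Chart data `chartData_piExpChart_translate` on both sides; an inner source ball inside the chart-readability region by continuity of `M` at `U₀`; a continuous bump
`r̃ = c₁·max(0, δ∕2 − ‖A‖)` at `0` below `(r∘Θ^B(·)·U₀)·J` on the ball — possible because `r` is continuous and positive at `U₀` and `J(0) > 0`; the face of `r̃`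
with positivity at `ψ(0)`; the transfer `PushforwardDensityPositivity.density_pos_of_chartRead`.)
[cite: Helgason2000, Ch. I §1 Thm. 1.14 (13) p. 96] [cite: Balaban1985UV3, (18) p. 260] [cite: EvansGariepy1992, §1.6.1 Thm 1] -/
theorem density_pos_pi_haar_of_chartRead [μ.IsMulRightInvariant] {B' : Type*} [Fintype B']
    {M : (B → G) → (B' → G)} (hMm : Measurable M) (U₀ : B → G) (hMc : ContinuousAt M U₀)
    (hflat : ∃ O : Set (B → C.lie), IsOpen O ∧ (0 : B → C.lie) ∈ O ∧ ∃ D : Set (B' → C.lie), IsOpen D ∧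
      (fun (A : B → C.lie) (b' : B') => h.logChart (M (fun b => h.expChart (A b) * U₀ b) b' * (M U₀ b')⁻¹)) 0 ∈ D ∧
      ∀ r : (B → C.lie) → ℝ, Measurable r → (∀ A, 0 ≤ r A) → ContinuousOn r O → (∃ C₀ : ℝ, ∀ A ∈ O, r A ≤ C₀) →
        (∀ A, A ∉ O → r A = 0) →
        ∃ I : (B' → C.lie) → ℝ, ContinuousOn I D ∧ (∀ w, 0 ≤ I w) ∧
          (0 < r 0 → 0 < I ((fun (A : B → C.lie) (b' : B') => h.logChart (M (fun b => h.expChart (A b) * U₀ b) b' * (M U₀ b')⁻¹)) 0)) ∧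
          ∀ A' : Set (B' → C.lie), MeasurableSet A' → A' ⊆ D →
            ((Measure.pi fun _ : B => η).withDensity fun A => ENNReal.ofReal (r A))
                ((fun (A : B → C.lie) (b' : B') => h.logChart (M (fun b => h.expChart (A b) * U₀ b) b' * (M U₀ b')⁻¹)) ⁻¹' A') =
              ∫⁻ w in A', ENNReal.ofReal (I w) ∂(Measure.pi fun _ : B' => η))
    {r : (B → G) → ℝ} (hrm : Measurable r) (hr0 : ∀ U, 0 ≤ r U) (hrc : ContinuousAt r U₀) (hrpos : 0 < r U₀)
    {DG : Set (B' → G)} (hDG : IsOpen DG) (hMDG : M U₀ ∈ DG) {I : (B' → G) → ℝ} (hIc : ContinuousAt I (M U₀))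
    (hI : ∀ S' : Set (B' → G), MeasurableSet S' → S' ⊆ DG →
      ((Measure.pi fun _ : B => μ).withDensity fun U => ENNReal.ofReal (r U)) (M ⁻¹' S') ≤
        ∫⁻ V in S', ENNReal.ofReal (I V) ∂(Measure.pi fun _ : B' => μ)) :
    0 < I (M U₀) := by
  haveI : T2Space G := h.isClosedEmbedding.isEmbedding.t2Space
  haveI := h.secondCountableTopology
  haveI : (Measure.pi fun _ : B' => η).IsAddHaarMeasure := Measure.pi.isAddHaarMeasure _
  -- the radius: inside the chart radius and the non-degeneracy ball of `det jac`
  obtain ⟨s₀, hs₀, hpos⟩ := exists_ball_det_jac_pos hlie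
  set s : ℝ := min (chartRadius C) s₀ with hsdef
  have hs0 : 0 < s := lt_min chartRadius_pos hs₀
  have hs : s ≤ chartRadius C := min_le_left _ _
  have hjpos : ∀ x : C.lie, ‖x‖ < s → 0 < LinearMap.det (jac hlie x : C.lie →ₗ[ℝ] C.lie) :=
    fun x hx => hpos x (hx.trans_le (min_le_right _ _))
  -- the Jacobian of the source chart, as a named function
  set JX : (B → C.lie) → ℝ := fun A => ((μ (h.window s) / h.chartMeasure hlie η s (h.window s)) ^ Fintype.card B).toReal *
      ∏ b, |LinearMap.det (jac hlie (A b) : C.lie →ₗ[ℝ] C.lie)| with hJXdef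
  -- the two sides' chart data
  obtain ⟨hΘXm, hΘXc, hΘXi, hΘXo, hJXm, hJXc, hJX0, -, hJXpos, hcovX, -, -, -, hΘX0⟩ :=
    h.chartData_piExpChart_translate hlie η μ hs0 hs hjpos U₀
  obtain ⟨hΘYm, hΘYc, hΘYi, hΘYo, hJYm, hJYc, -, -, hJYpos, hcovY, hΛYm, -, hΛΘY, hΘY0⟩ :=
    h.chartData_piExpChart_translate hlie η μ hs0 hs hjpos (M U₀)
  -- the inner source ball: inside `B(0, s/2)` and the chart-readability region
  have hDGo : IsOpen ((fun (A : B' → C.lie) (b' : B') => h.expChart (A b') * M U₀ b') '' Metric.ball 0 s) :=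
    hΘYo _ Subset.rfl Metric.isOpen_ball
  have hΘXc0 : ContinuousAt (fun (A : B → C.lie) (b : B) => h.expChart (A b) * U₀ b) 0 :=
    hΘXc.continuousAt (Metric.isOpen_ball.mem_nhds (Metric.mem_ball_self hs0))
  have hMc0 : ContinuousAt M ((fun (A : B → C.lie) (b : B) => h.expChart (A b) * U₀ b) 0) := by
    show ContinuousAt M (fun b => h.expChart ((0 : B → C.lie) b) * U₀ b)
    rw [hΘX0]
    exact hMc
  have hN : (fun A : B → C.lie => M (fun b => h.expChart (A b) * U₀ b)) ⁻¹'
      ((fun (A : B' → C.lie) (b' : B') => h.expChart (A b') * M U₀ b') '' Metric.ball 0 s) ∈ 𝓝 (0 : B → C.lie) := by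
    have hc : ContinuousAt (fun A : B → C.lie => M (fun b => h.expChart (A b) * U₀ b)) 0 :=
      ContinuousAt.comp (g := M) (f := fun (A : B → C.lie) (b : B) => h.expChart (A b) * U₀ b) hMc0 hΘXc0
    refine hc.preimage_mem_nhds (hDGo.mem_nhds ?_)
    show M (fun b => h.expChart ((0 : B → C.lie) b) * U₀ b) ∈ _
    rw [hΘX0]
    exact ⟨0, Metric.mem_ball_self hs0, hΘY0⟩
  obtain ⟨t₁, ht₁, ht₁N⟩ := Metric.mem_nhds_iff.1 hN
  set t : ℝ := min (s / 2) t₁ with htdef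
  have ht0 : 0 < t := lt_min (half_pos hs0) ht₁
  have hts : t < s := (min_le_left _ _).trans_lt (half_lt_self hs0)
  have hT₀T : Metric.ball (0 : B → C.lie) t ⊆ Metric.ball 0 s := Metric.ball_subset_ball hts.le
  have hread : ∀ A ∈ Metric.ball (0 : B → C.lie) t,
      M ((fun (A : B → C.lie) (b : B) => h.expChart (A b) * U₀ b) A) ∈
        (fun (A : B' → C.lie) (b' : B') => h.expChart (A b') * M U₀ b') '' Metric.ball 0 s :=
    fun A hA => ht₁N (Metric.ball_subset_ball (min_le_right _ _) hA)
  -- the flat face with positivity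
  obtain ⟨O, hO, h0O, D, hD, hm0D, hface⟩ := hflat
  -- `r ∘ Θ^B(·)·U₀` is continuous at `0`; the Jacobian is positive at `0`
  have hrΘ : ContinuousAt (fun A : B → C.lie => r (fun b => h.expChart (A b) * U₀ b)) 0 := by
    have h1 : ContinuousAt r ((fun (A : B → C.lie) (b : B) => h.expChart (A b) * U₀ b) 0) := by
      show ContinuousAt r (fun b => h.expChart ((0 : B → C.lie) b) * U₀ b)
      rw [hΘX0]; exact hrc
    exact ContinuousAt.comp (g := r) (f := fun (A : B → C.lie) (b : B) => h.expChart (A b) * U₀ b) h1 hΘXc0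
  have hr0val : r (fun b => h.expChart ((0 : B → C.lie) b) * U₀ b) = r U₀ := by rw [hΘX0]
  have hJ₀pos : 0 < JX 0 := hJXpos 0 (Metric.mem_ball_self hs0)
  -- a neighbourhood of `0` inside `O ∩ B(0,t)` on which `r∘Θ > r(U₀)/2` and `JX > JX(0)/2`, and a ball inside it
  have hW₀ : O ∩ Metric.ball 0 t ∩ {A | r U₀ / 2 < r (fun b => h.expChart (A b) * U₀ b)} ∩ {A | JX 0 / 2 < JX A} ∈ 𝓝 (0 : B → C.lie) := by
    refine inter_mem (inter_mem (inter_mem (hO.mem_nhds h0O) (Metric.isOpen_ball.mem_nhds (Metric.mem_ball_self ht0))) ?_) ?_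
    · exact hrΘ.preimage_mem_nhds (Ioi_mem_nhds (by rw [hr0val]; linarith))
    · exact (hJXc.continuousAt (Metric.isOpen_ball.mem_nhds (Metric.mem_ball_self hs0))).preimage_mem_nhds
        (Ioi_mem_nhds (by linarith))
  obtain ⟨δ, hδ, hδW⟩ := Metric.mem_nhds_iff.1 hW₀
  -- the bump
  set bump : (B → C.lie) → ℝ := fun A => max 0 (δ / 2 - ‖A‖) with hbump
  have hbump_cont : Continuous bump := continuous_const.max (continuous_const.sub continuous_norm)
  have hbump0 : ∀ A, 0 ≤ bump A := fun A => le_max_left _ _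
  have hbump_le : ∀ A, bump A ≤ δ / 2 := fun A => max_le (by linarith) (by linarith [norm_nonneg A])
  have hbump_supp : ∀ A, bump A ≠ 0 → A ∈ Metric.ball (0 : B → C.lie) δ := by
    intro A hA
    rw [mem_ball_zero_iff]
    by_contra hge
    rw [not_lt] at hge
    exact hA (max_eq_left (by linarith))
  have hbump_zero : bump 0 = δ / 2 := by
    show max 0 (δ / 2 - ‖(0 : B → C.lie)‖) = δ / 2
    rw [norm_zero, sub_zero, max_eq_right (by linarith)]
  set c₁ : ℝ := r U₀ / 2 * (JX 0 / 2) * (2 / δ) with hc₁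
  have hc₁pos : 0 < c₁ := by positivity
  set rE : (B → C.lie) → ℝ := fun A => c₁ * bump A with hrE
  have hrEm : Measurable rE := (continuous_const.mul hbump_cont).measurable
  have hrE0 : ∀ A, 0 ≤ rE A := fun A => mul_nonneg hc₁pos.le (hbump0 A)
  have hrEle' : ∀ A, rE A ≤ r U₀ / 2 * (JX 0 / 2) := by
    intro A
    calc rE A = r U₀ / 2 * (JX 0 / 2) * (2 / δ * bump A) := by rw [hrE, hc₁]; ring
      _ ≤ r U₀ / 2 * (JX 0 / 2) * 1 := by
          refine mul_le_mul_of_nonneg_left ?_ (by positivity)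
          rw [div_mul_eq_mul_div, div_le_one hδ]
          linarith [hbump_le A]
      _ = _ := mul_one _
  have hrE_zero_of : ∀ A, bump A = 0 → rE A = 0 := fun A hb => by show c₁ * bump A = 0; rw [hb, mul_zero]
  have hrEO : ∀ A, A ∉ O → rE A = 0 := fun A hA =>
    hrE_zero_of A (by by_contra hne; exact hA (hδW (hbump_supp A hne)).1.1.1)
  have hrET₀ : ∀ A, A ∉ Metric.ball (0 : B → C.lie) t → rE A = 0 := fun A hA =>
    hrE_zero_of A (by by_contra hne; exact hA (hδW (hbump_supp A hne)).1.1.2)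
  have hrEpos : 0 < rE 0 := by
    show 0 < c₁ * bump 0
    rw [hbump_zero]; positivity
  have hrEle : ∀ A ∈ Metric.ball (0 : B → C.lie) s,
      rE A ≤ r ((fun (A : B → C.lie) (b : B) => h.expChart (A b) * U₀ b) A) * JX A := by
    intro A _
    by_cases hb : bump A = 0
    · rw [hrE_zero_of A hb]
      exact mul_nonneg (hr0 _) (hJX0 A)
    · have hAW := hδW (hbump_supp A hb)
      have h1 : r U₀ / 2 < r (fun b => h.expChart (A b) * U₀ b) := hAW.1.2
      have h2 : JX 0 / 2 < JX A := hAW.2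
      have hJ₀2 : 0 ≤ JX 0 / 2 := by positivity
      exact (hrEle' A).trans (mul_le_mul h1.le h2.le hJ₀2 (hr0 _))
  -- the face of the bump, with positivity at `ψ(0)`
  obtain ⟨IE, hIEc, -, hIEpos, hIE⟩ := hface rE hrEm hrE0 ((continuous_const.mul hbump_cont).continuousOn)
    ⟨r U₀ / 2 * (JX 0 / 2), fun A _ => hrEle' A⟩ hrEO
  -- the base point of the target chart
  have hMa : M ((fun (A : B → C.lie) (b : B) => h.expChart (A b) * U₀ b) 0) = M U₀ := by
    show M (fun b => h.expChart ((0 : B → C.lie) b) * U₀ b) = M U₀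
    rw [hΘX0]
  have hMaDG : M ((fun (A : B → C.lie) (b : B) => h.expChart (A b) * U₀ b) 0) ∈ DG := by rw [hMa]; exact hMDG
  have hIc' : ContinuousAt I (M ((fun (A : B → C.lie) (b : B) => h.expChart (A b) * U₀ b) 0)) := by rw [hMa]; exact hIc
  -- the transfer
  have hpos := density_pos_of_chartRead
    (Measure.pi fun _ : B => η) (Measure.pi fun _ : B' => η) (Measure.pi fun _ : B => μ) (Measure.pi fun _ : B' => μ)
    hΘXm Metric.isOpen_ball hT₀T (hΘXo _ Subset.rfl Metric.isOpen_ball) hJXm hJX0 hcovX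
    hΘYm Metric.isOpen_ball hΘYi hΘYc hΘYo hΛYm hΛΘY hJYm hJYc hJYpos hcovY
    hMm (Metric.mem_ball_self ht0) hread hrm hrEle hrET₀ hD hm0D
    (hIEc.continuousAt (hD.mem_nhds hm0D)) (hIEpos hrEpos) hIE hDG hMaDG hIc' hI
  rw [hMa] at hpos
  exact hpos

end IsChartRep

end Literature.MathematicalPhysics.QuantumFieldTheory.Balaban1983to89.HaarExponentialChart

end
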